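import Literature.NumberTheory.Sieve.LevelOfDistribution
import HarnessLib

/-!
# Motohashi's generalized Bombieri–Vinogradov theorem: `GEH[ϑ]` for every `0 < ϑ < 1/2`

Topic `NumberTheory/Sieve`; namespace `Literature.NumberTheory.Sieve`. A NAMED FACT (D-0014):
the proved half of the generalized Elliott–Halberstam conjecture, in the shape in which the tree
states that conjecture (`GeneralizedElliottHalberstam ϑ`, `LevelOfDistribution.lean` = Polymath 8b,
arXiv:1407.4897, Claim 2.6).

D. H. J. Polymath, *Variants of the Selberg sieve, and bounded intervals containing many primes*,
Res. Math. Sci. 1:12 (2014) = arXiv:1407.4897 (held text `paper:arxiv-1407.4897`, read; arXiv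
numbering), §2 p. 7, verbatim: "By modifying the proof of the Bombieri-Vinogradov theorem Motohashi
[motohashi] established the following generalization of that theorem (see also [gallagher] for some
related ideas): **Theorem 2.8 (Generalized Bombieri-Vinogradov theorem).** [motohashi] `GEH[ϑ]`
holds for every fixed `0 < ϑ < 1/2`." The reference [motohashi] is Y. Motohashi, *An induction
principle for the generalization of Bombieri's prime number theorem*, Proc. Japan Acad. 52 (1976),
273–275.

Relation to the tree. The same theorem in the shape of Bombieri–Friedlander–Iwaniec 1986,
Theorem 0 (b) (dyadic supports, hypotheses (A₁), (A₂), level `x^{1/2} ℒ^{−B₁}`) is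
`Literature.NumberTheory.Sieve.BombieriFriedlanderIwaniecTheorem0b`, PROVED in the tree from the
large sieve (`BombieriFriedlanderIwaniecTheorem0b_holds`). Deriving the present Polymath-shaped
statement from it is a bookkeeping exercise (supports `[N, KN]` instead of `(N, 2N]`, Polymath's
divisor bounds and Siegel–Walfisz hypothesis instead of (A₂), the range `q ≤ x^ϑ`, `ϑ < 1/2`, inside
`Q ≤ x^{1/2} ℒ^{−B₁}`), NOT done here: this file only names the printed statement so that routes
conditional on `GEH[ϑ]` can see which slice of their hypothesis is a theorem. The complementary
range `1/2 ≤ ϑ < 1` is the open part of the conjecture (Polymath 8b, after Claim 2.6: "In [bfi] it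
was essentially conjectured … that `GEH[ϑ]` was true for all `0 < ϑ < 1`").

Grounds (partially — the `ϑ < 1/2` slice only) the route item
`Summit.Parity.GeneralizedHardyLittlewood.Theses.RoughSemiprimeRigidity.GEH`
(`∀ θ < 1, GeneralizedElliottHalberstam θ`, stmt-Parity-14176), which is STRONGER than print.

## References

* [Polymath8b2014] arXiv:1407.4897, §2: Claim 2.6 (`GEH[ϑ]`), Proposition 2.7 (`GEH ⟹ EH`),
  Theorem 2.8 (Motohashi's generalized Bombieri–Vinogradov theorem), p. 7.
* [Motohashi1976] Y. Motohashi, Proc. Japan Acad. 52 (1976), 273–275.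
* [BombieriFriedlanderIwaniecActa1986] Acta Math. 156 (1986), Theorem 0 (b), p. 211.
-/

noncomputable section

namespace Literature.NumberTheory.Sieve

/-- **Motohashi's generalized Bombieri–Vinogradov theorem** (Polymath 8b, arXiv:1407.4897,
Theorem 2.8, p. 7, verbatim: "[motohashi] `GEH[ϑ]` holds for every fixed `0 < ϑ < 1/2`"), with
`GEH[ϑ]` the tree's rendering `GeneralizedElliottHalberstam ϑ` of Polymath's Claim 2.6: for
coefficient sequences `α`, `β` at scales `N`, `M` (`x^ε ≤ N, M ≤ x^{1−ε}`, `NM ≍ x`),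
divisor-bounded, `β` Siegel–Walfisz, `∑_{q ≤ x^ϑ} max_{(a,q)=1} |Δ(α ⋆ β; a (q))| ≪_A x (log x)^{−A}`
whenever `0 < ϑ < 1/2`. A deep theorem (large sieve / dispersion), NOT proved here; the BFI-shaped
twin `BombieriFriedlanderIwaniecTheorem0b` is proved in the tree. Partially grounds
`Summit.Parity.GeneralizedHardyLittlewood.Theses.RoughSemiprimeRigidity.GEH` (stmt-Parity-14176:
all `θ < 1`, stronger than print). [cite: Polymath8b2014, Theorem 2.8] [cite: Motohashi1976] -/
def Motohashi1976_generalizedBombieriVinogradov : Prop :=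
  ∀ ϑ : ℝ, 0 < ϑ → ϑ < 1 / 2 → GeneralizedElliottHalberstam ϑ

/-- Unfolding lemma. [cite: Polymath8b2014, Theorem 2.8] -/
theorem Motohashi1976_generalizedBombieriVinogradov_iff :
    Motohashi1976_generalizedBombieriVinogradov ↔
      ∀ ϑ : ℝ, 0 < ϑ → ϑ < 1 / 2 → GeneralizedElliottHalberstam ϑ :=
  Iff.rfl

/-- Under Motohashi's theorem, the generalized Elliott–Halberstam hypothesis "`GEH[ϑ]` for all
`ϑ < 1`" of a conditional route reduces to its open upper range `1/2 ≤ ϑ < 1` (the slice `ϑ ≤ 0`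
being supplied by the hypothesis `h0`, in practice vacuous: the modulus range `q ≤ x^ϑ` is then
`q ≤ 1`). [cite: Polymath8b2014, Theorem 2.8] -/
theorem forall_generalizedElliottHalberstam_of_upper_range
    (hM : Motohashi1976_generalizedBombieriVinogradov)
    (h0 : ∀ ϑ : ℝ, ϑ ≤ 0 → GeneralizedElliottHalberstam ϑ)
    (h1 : ∀ ϑ : ℝ, 1 / 2 ≤ ϑ → ϑ < 1 → GeneralizedElliottHalberstam ϑ) :
    ∀ ϑ : ℝ, ϑ < 1 → GeneralizedElliottHalberstam ϑ := by
  intro ϑ hϑ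
  rcases le_or_gt ϑ 0 with h | h
  · exact h0 ϑ h
  · rcases lt_or_ge ϑ (1 / 2) with h' | h'
    · exact hM ϑ h h'
    · exact h1 ϑ h' hϑ

end Literature.NumberTheory.Sieve
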